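import Mathlib
import Summits.Schanuel.Schanuel.Theorems.RigidCoreTwoLogsBranchRelationFinite

/-!
# Rational points `(t x, λ + t y)` on an algebraic curve (core of `stub_mixedPeriodPocket`)

Helper file for crux stmt-Schanuel-0971 (`RigidCore.SparsityTwo`, line cusp-germ-schneider-sparsity; lattice
translates of two logarithms with CONSTANT, ℚ-DEPENDENT data). Let `𝔸 = ℚ̄ ⊂ ℂ`, `t ∈ ℂ` transcendental over `𝔸`,
and `1, λ, t` linearly independent over `𝔸` (for `t = 2πi`, `λ = log` of a non-torsion algebraic number:
Hermite–Lindemann and Baker). Then a nonzero `R ∈ 𝔸[X₀, X₁]` has only finitely many RATIONAL zeros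
`(t x, λ + t y)`, `(x, y) ∈ ℚ²`, `x ≠ 0` (`MixedPeriod.finite_ratPoints`, re-exported as the registered stub
`stub_mixedPeriodCore`). Proof: the functional / top-form argument of `finite_zeros_of_irreducible` (Theorem L,
item 0975; steps (1)–(6) copied): for irreducible `R` of degree `d`, `P := R(tX₀, λ + tX₁)` is irreducible in
`ℂ[X₀, X₁]`; an `𝔸`-linear `φ : ℂ → 𝔸` with `φ(t^d) = 1` gives `f := ∑ φ(coeff n P) Xⁿ ∈ 𝔸[X]` vanishing at
all rational zeros of `P`; either `P, f` are coprime (finitely many common zeros) or `P ∣ f`, i.e. every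
coefficient of `P` lies in `t^d · 𝔸`; then a descending induction inside each column `X₀^{n₀}` (`n₀ < d`) kills
every coefficient of `R` except that of `X₀^d` — the two top entries by the independence of `1, λ, t`
(`coeff_aeval_affine_next`), the lower ones by the transcendence of `t` — so `R = c X₀^d`, whose zeros have
`x = 0`: the set is empty.
-/

noncomputable section
-- `Summit.Schanuel.Schanuel` (summit = problem) trips core's duplicate-namespace linter.
set_option linter.dupNamespace false

namespace Summit.Schanuel.Schanuel.Theorems
open MvPolynomial RigidCore.TwoLogs

/-- **Irreducible case.** For `t` transcendental over `𝔸`, `1, λ, t` linearly independent over `𝔸`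
and `R ∈ 𝔸[X₀, X₁]` irreducible, only finitely many rational `(x, y)` with `x ≠ 0` satisfy
`R(t x, λ + t y) = 0` (written with `l = (0, λ)` as `R(l + t·(x, y)) = 0`). -/
theorem MixedPeriod.finite_zeros_of_irreducible (lam t : ℂ)
    (ht : Transcendental (algebraicClosure ℚ ℂ) t)
    (hli : LinearIndependent (algebraicClosure ℚ ℂ) ![(1 : ℂ), lam, t])
    (R : MvPolynomial (Fin 2) (algebraicClosure ℚ ℂ)) (hR : Irreducible R) :
    {q : ℚ × ℚ | q.1 ≠ 0 ∧ aeval (fun i => (![0, lam] : Fin 2 → ℂ) i +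
      t * (((![q.1, q.2] : Fin 2 → ℚ) i : ℚ) : ℂ)) R = 0}.Finite := by
  classical
  haveI : IsAlgClosure ℚ (algebraicClosure ℚ ℂ) := algebraicClosure.isAlgClosure ℚ ℂ
  haveI : IsAlgClosed (algebraicClosure ℚ ℂ) := IsAlgClosure.isAlgClosed ℚ
  have ht0 : t ≠ 0 := fun h => ht (h ▸ isAlgebraic_zero)
  set l : Fin 2 → ℂ := ![0, lam] with hl
  have hl0 : l 0 = 0 := rfl
  have hl1 : l 1 = lam := rfl
  set ι : (algebraicClosure ℚ ℂ) →+* ℂ := algebraMap (algebraicClosure ℚ ℂ) ℂ with hι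
  have hιinj : Function.Injective ι := ι.injective
  set d := R.totalDegree with hd
  set g : Fin 2 → MvPolynomial (Fin 2) ℂ := fun i => C (l i) + C t * X i with hg
  set P : MvPolynomial (Fin 2) ℂ := aeval g R with hP
  have hR0 : R ≠ 0 := hR.ne_zero
  -- (1) `P` as a substitution into `map ι R`
  have hPmap : P = aeval g (map ι R) := (aeval_map_algebraMap ℂ g R).symm
  have hsupp : (map ι R).support = R.support := support_map_of_injective R hιinj
  have hdeg' : (map ι R).totalDegree = d := by simp only [totalDegree, hsupp, hd]
  -- (2) `P` is irreducible (the affine substitution is an automorphism of `ℂ[X₀, X₁]`)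
  have hPirr : Irreducible P := by
    have h1 : Irreducible (map ι R) := irreducible_map_of_isAlgClosed hR
    set g' : Fin 2 → MvPolynomial (Fin 2) ℂ := fun i => C (-(l i) * t⁻¹) + C t⁻¹ * X i with hg'
    have hc1 : (aeval g : MvPolynomial (Fin 2) ℂ →ₐ[ℂ] MvPolynomial (Fin 2) ℂ).comp (aeval g') =
        AlgHom.id ℂ _ := by
      apply MvPolynomial.algHom_ext
      intro i
      simp only [AlgHom.comp_apply, AlgHom.id_apply, aeval_X, aeval_C, hg, hg', map_add, map_mul,
        algebraMap_eq]
      calc _ = (C (-(l i) * t⁻¹ + t⁻¹ * l i) + C (t⁻¹ * t) * X i : MvPolynomial (Fin 2) ℂ) := by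
            simp only [map_add, map_mul]; ring
        _ = X i := by
            rw [inv_mul_cancel₀ ht0, show -(l i) * t⁻¹ + t⁻¹ * l i = 0 by ring, C_0, C_1]; ring
    have hc2 : (aeval g' : MvPolynomial (Fin 2) ℂ →ₐ[ℂ] MvPolynomial (Fin 2) ℂ).comp (aeval g) =
        AlgHom.id ℂ _ := by
      apply MvPolynomial.algHom_ext
      intro i
      simp only [AlgHom.comp_apply, AlgHom.id_apply, aeval_X, aeval_C, hg, hg', map_add, map_mul,
        algebraMap_eq]
      calc _ = (C (l i + -(l i) * (t⁻¹ * t)) + C (t * t⁻¹) * X i : MvPolynomial (Fin 2) ℂ) := by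
            simp only [map_add, map_mul]; ring
        _ = X i := by
            rw [inv_mul_cancel₀ ht0, mul_inv_cancel₀ ht0, show l i + -(l i) * 1 = 0 by ring, C_0,
              C_1]
            ring
    let E : MvPolynomial (Fin 2) ℂ ≃ₐ[ℂ] MvPolynomial (Fin 2) ℂ :=
      AlgEquiv.ofAlgHom (aeval g) (aeval g') hc1 hc2
    have hE : ∀ q, E q = aeval g q := fun q => rfl
    rw [hPmap, ← hE]
    exact (MulEquiv.irreducible_iff E).mpr h1
  -- (3) evaluation of `P`
  have heval : ∀ x : Fin 2 → ℂ, eval x P = aeval (fun i => l i + t * x i) R := by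
    intro x
    have hhom : (eval x).comp
        (aeval g : MvPolynomial (Fin 2) (algebraicClosure ℚ ℂ) →ₐ[algebraicClosure ℚ ℂ]
          MvPolynomial (Fin 2) ℂ).toRingHom =
        (aeval (fun i => l i + t * x i) :
          MvPolynomial (Fin 2) (algebraicClosure ℚ ℂ) →ₐ[algebraicClosure ℚ ℂ] ℂ).toRingHom := by
      apply MvPolynomial.ringHom_ext
      · intro r
        simp [MvPolynomial.algebraMap_apply]
      · intro i
        simp [hg]
    exact RingHom.congr_fun hhom R
  -- (4) top monomial and coefficient facts
  obtain ⟨n₀, hn₀, hdn₀⟩ := Finset.exists_mem_eq_sup R.support (support_nonempty.mpr hR0)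
    (fun s => s.sum fun _ e => e)
  have hn₀d : n₀ 0 + n₀ 1 = d := by
    rw [← degree_fin_two]; exact hdn₀.symm
  have hr₀ : coeff n₀ R ≠ 0 := mem_support_iff.mp hn₀
  have cP_top : ∀ n : Fin 2 →₀ ℕ, n 0 + n 1 = d → coeff n P = t ^ d * ι (coeff n R) := by
    intro n hn
    rw [hPmap, coeff_aeval_affine_top l t (map ι R) n (by rw [hdeg']; exact hn), coeff_map, hn]
  have cP_next : ∀ n : Fin 2 →₀ ℕ, n 0 + n 1 + 1 = d → coeff n P =
      t ^ (n 0 + n 1) * (ι (coeff n R)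
        + ((n 0 + 1 : ℕ) : ℂ) * ι (coeff (n + Finsupp.single 0 1) R) * l 0
        + ((n 1 + 1 : ℕ) : ℂ) * ι (coeff (n + Finsupp.single 1 1) R) * l 1) := by
    intro n hn
    rw [hPmap, coeff_aeval_affine_next l t (map ι R) n (by rw [hdeg']; exact hn)]
    simp only [coeff_map]
  have cP_zero : ∀ n : Fin 2 →₀ ℕ, d < n 0 + n 1 → coeff n P = 0 := by
    intro n hn
    by_contra h
    have := degree_le_of_coeff_aeval_affine_ne_zero l t (map ι R) n (by rw [← hPmap]; exact h)
    rw [hdeg'] at this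
    omega
  have hPn₀ : coeff n₀ P ≠ 0 := by
    rw [cP_top n₀ hn₀d]
    exact mul_ne_zero (pow_ne_zero _ ht0) ((map_ne_zero_iff ι hιinj).mpr hr₀)
  have hP0 : P ≠ 0 := fun h => hPn₀ (by rw [h, coeff_zero])
  have hPdeg : P.totalDegree = d := by
    apply le_antisymm
    · apply Finset.sup_le
      intro n hn
      rw [degree_fin_two]
      by_contra hlt
      exact (mem_support_iff.mp hn) (cP_zero n (by omega))
    · have := le_totalDegree (mem_support_iff.mpr hPn₀)
      rw [degree_fin_two, hn₀d] at this
      exact this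
  -- (5) a `ℚ̄`-linear functional with `φ (t ^ d) = 1`
  obtain ⟨φ, hφ⟩ : ∃ φ : ℂ →ₗ[(algebraicClosure ℚ ℂ)] (algebraicClosure ℚ ℂ), φ (t ^ d) = 1 := by
    have htd : (t ^ d : ℂ) ≠ 0 := pow_ne_zero _ ht0
    obtain ⟨γ, hγ⟩ := LinearMap.exists_leftInverse_of_injective
      (LinearMap.toSpanSingleton (algebraicClosure ℚ ℂ) ℂ (t ^ d))
      (LinearMap.ker_toSpanSingleton (algebraicClosure ℚ ℂ) htd)
    refine ⟨γ, ?_⟩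
    have := LinearMap.congr_fun hγ 1
    simpa [LinearMap.toSpanSingleton_apply] using this
  -- (6) the functional image `f₁` and its base change `f₁'`
  set f₁ : MvPolynomial (Fin 2) (algebraicClosure ℚ ℂ) :=
    ∑ m ∈ P.support, monomial m (φ (coeff m P)) with hf₁
  have cf₁ : ∀ n, coeff n f₁ = φ (coeff n P) := fun n => coeff_sum_monomial_apply φ P n
  have hφn₀ : φ (coeff n₀ P) = coeff n₀ R := by
    rw [cP_top n₀ hn₀d, show t ^ d * ι (coeff n₀ R) = (coeff n₀ R) • (t ^ d) by
      rw [Algebra.smul_def, mul_comm], map_smul, hφ, smul_eq_mul, mul_one]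
  have hf₁0 : f₁ ≠ 0 := by
    intro h
    apply hr₀
    rw [← hφn₀, ← cf₁, h, coeff_zero]
  set f₁' : MvPolynomial (Fin 2) ℂ := map ι f₁ with hf₁'
  have hf₁'0 : f₁' ≠ 0 := by
    intro h
    exact hf₁0 ((map_injective ι hιinj) (by rw [← hf₁', h, map_zero]))
  have hf₁'deg : f₁'.totalDegree ≤ d := by
    apply Finset.sup_le
    intro n hn
    rw [degree_fin_two]
    by_contra hlt
    apply mem_support_iff.mp hn
    rw [hf₁', coeff_map, cf₁, cP_zero n (by omega), map_zero, map_zero]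
  -- (7) dichotomy: `P ∣ f₁'` or the two are relatively prime
  rcases hPirr.dvd_or_isRelPrime (n := f₁') with hdvd | hrel
  · -- divisible: every coefficient of `P` lies in `t ^ d · ℚ̄`; we show that the set is empty
    obtain ⟨q, hq⟩ := hdvd
    have hq0 : q ≠ 0 := by
      rintro rfl
      exact hf₁'0 (by rw [hq, mul_zero])
    have hqdeg : q.totalDegree = 0 := by
      have := totalDegree_mul_of_isDomain hP0 hq0
      rw [← hq, hPdeg] at this
      omega
    rw [totalDegree_eq_zero_iff_eq_C] at hqdeg
    set c := coeff 0 q with hc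
    have hcoef : ∀ n, ι (φ (coeff n P)) = coeff n P * c := by
      intro n
      have := congrArg (coeff n) hq
      rw [hf₁', coeff_map, cf₁, hqdeg, mul_comm, coeff_C_mul] at this
      rw [this, mul_comm]
    have htc : t ^ d * c = 1 := by
      have h1 := hcoef n₀
      rw [hφn₀, cP_top n₀ hn₀d] at h1
      have hι0 : ι (coeff n₀ R) ≠ 0 := (map_ne_zero_iff ι hιinj).mpr hr₀
      have : ι (coeff n₀ R) * (t ^ d * c) = ι (coeff n₀ R) * 1 := by
        rw [mul_one]; linear_combination h1.symm
      exact mul_left_cancel₀ hι0 this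
    -- step 1 (degree `d - 1`): `R_n = 0` and `R_{n + e₁} = 0`, by the independence of `1, λ, t`
    have step1 : ∀ n : Fin 2 →₀ ℕ, n 0 + n 1 + 1 = d →
        coeff n R = 0 ∧ coeff (n + Finsupp.single 1 1) R = 0 := by
      intro n hnd
      set a := φ (coeff n P) with ha
      have key : ι a = coeff n P * c := hcoef n
      rw [cP_next n hnd, hl0, hl1, mul_zero, add_zero] at key
      have key2 : ι a * t =
          ι (coeff n R) + ((n 1 + 1 : ℕ) : ℂ) * ι (coeff (n + Finsupp.single 1 1) R) * lam := by
        have htpow : t ^ d = t ^ (n 0 + n 1) * t := by rw [← hnd, pow_succ]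
        calc ι a * t = (ι (coeff n R)
              + ((n 1 + 1 : ℕ) : ℂ) * ι (coeff (n + Finsupp.single 1 1) R) * lam)
                * (t ^ d * c) := by
              rw [key, htpow]; ring
          _ = _ := by rw [htc, mul_one]
      have hcomb := (Fintype.linearIndependent_iff.mp hli)
        ![coeff n R, ((n 1 + 1 : ℕ) : algebraicClosure ℚ ℂ) * coeff (n + Finsupp.single 1 1) R,
          -a] (by
          rw [Fin.sum_univ_three]
          simp only [Matrix.cons_val_zero, Matrix.cons_val_one, Matrix.cons_val_two,
            Matrix.head_cons, Matrix.tail_cons, Algebra.smul_def, map_mul, map_natCast, map_neg,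
            ← hι]
          linear_combination -key2)
      have hc0 := hcomb 0
      have hc1 := hcomb 1
      simp only [Matrix.cons_val_zero, Matrix.cons_val_one, mul_eq_zero, Nat.cast_eq_zero,
        Nat.succ_ne_zero, false_or] at hc0 hc1
      exact ⟨hc0, hc1⟩
    -- step 2 (degree `≤ d - 2`, lower entries of a column): `R_n = 0` by the transcendence of `t`
    have step2 : ∀ n : Fin 2 →₀ ℕ, n 0 + n 1 + 2 ≤ d →
        (∀ m : Fin 2 →₀ ℕ, m 0 = n 0 → n 1 < m 1 → coeff m R = 0) → coeff n R = 0 := by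
      intro n hnd IH
      by_contra hRn
      have hcoeffP : coeff n P = ι (coeff n R) * t ^ (n 0 + n 1) := by
        rw [hPmap, coeff_aeval_affine, Finset.sum_eq_single n]
        · rw [coeff_map, coeff_linear_pow_mul, if_pos ⟨le_rfl, le_rfl⟩]
          simp only [Nat.sub_self, pow_zero, mul_one, Nat.choose_self, Nat.cast_one]
          ring
        · intro m _ hmn
          rw [coeff_linear_pow_mul]
          split_ifs with hle
          · rcases Nat.eq_or_lt_of_le hle.1 with h0 | h0
            · have h1 : n 1 < m 1 := by
                rcases Nat.eq_or_lt_of_le hle.2 with h1 | h1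
                · exact absurd ((finsupp_fin_two_eq_iff m n).mpr ⟨h0.symm, h1.symm⟩) hmn
                · exact h1
              rw [coeff_map, IH m h0.symm h1, map_zero, zero_mul]
            · rw [hl0, zero_pow (by omega : m 0 - n 0 ≠ 0)]
              ring
          · rw [mul_zero]
        · intro hn'
          rw [notMem_support_iff.mp hn', zero_mul]
      set s := d - (n 0 + n 1) with hs
      have htd : t ^ d = t ^ (n 0 + n 1) * t ^ s := by
        rw [← pow_add]; congr 1; omega
      have key : ι (φ (coeff n P)) * t ^ s = ι (coeff n R) := by
        rw [hcoef n, hcoeffP]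
        calc ι (coeff n R) * t ^ (n 0 + n 1) * c * t ^ s = ι (coeff n R) * (t ^ d * c) := by
              rw [htd]; ring
          _ = ι (coeff n R) := by rw [htc, mul_one]
      have hφ0 : ι (φ (coeff n P)) ≠ 0 := by
        intro h0
        rw [h0, zero_mul] at key
        exact hRn ((map_eq_zero_iff ι hιinj).mp key.symm)
      apply ht
      have halg : IsAlgebraic (algebraicClosure ℚ ℂ) (t ^ s) := by
        have : t ^ s = ι (coeff n R / φ (coeff n P)) := by
          rw [map_div₀, eq_div_iff hφ0, mul_comm, ← key, mul_comm]
        rw [this]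
        exact isAlgebraic_algebraMap _
      exact halg.of_pow (by omega)
    -- assembling: every coefficient of `R` other than that of `X₀ ^ d` vanishes
    have hdegv : ∀ m : Fin 2 →₀ ℕ, d < m 0 + m 1 → coeff m R = 0 := by
      intro m hm
      by_contra h
      have := le_totalDegree (mem_support_iff.mpr h)
      rw [degree_fin_two, ← hd] at this
      omega
    have htopv : ∀ m : Fin 2 →₀ ℕ, m 0 + m 1 = d → 1 ≤ m 1 → coeff m R = 0 := by
      intro m hm h1
      have e : m - Finsupp.single 1 1 + Finsupp.single 1 1 = m :=
        tsub_add_cancel_of_le (Finsupp.single_le_iff.mpr h1)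
      have e0 : (m - Finsupp.single (1 : Fin 2) 1 : Fin 2 →₀ ℕ) 0 = m 0 := by simp
      have e1 : (m - Finsupp.single (1 : Fin 2) 1 : Fin 2 →₀ ℕ) 1 = m 1 - 1 := by simp
      have h := (step1 (m - Finsupp.single 1 1) (by rw [e0, e1]; omega)).2
      rwa [e] at h
    have hlocal : ∀ n : Fin 2 →₀ ℕ, n 0 < d →
        (∀ m : Fin 2 →₀ ℕ, m 0 = n 0 → n 1 < m 1 → coeff m R = 0) → coeff n R = 0 := by
      intro n hn0 IH
      rcases (show d < n 0 + n 1 ∨ n 0 + n 1 = d ∨ n 0 + n 1 + 1 = d ∨ n 0 + n 1 + 2 ≤ d by omega)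
        with h | h | h | h
      · exact hdegv n h
      · exact htopv n h (by omega)
      · exact (step1 n h).1
      · exact step2 n h IH
    have hcol : ∀ k : ℕ, ∀ n : Fin 2 →₀ ℕ, n 0 < d → d + 1 ≤ n 0 + n 1 + k → coeff n R = 0 := by
      intro k
      induction k using Nat.strong_induction_on with
      | _ k IHk =>
        intro n hn0 hk
        apply hlocal n hn0
        intro m hm0 hm1
        by_cases hdm : d < m 0 + m 1
        · exact hdegv m hdm
        · exact IHk (d + 1 - (m 0 + m 1)) (by omega) m (by omega) (by omega)
    have hall : ∀ n : Fin 2 →₀ ℕ, n ≠ Finsupp.single 0 d → coeff n R = 0 := by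
      intro n hn
      by_cases hn0 : n 0 < d
      · exact hcol (d + 1) n hn0 (by omega)
      · apply hdegv n
        by_contra hle
        apply hn
        rw [finsupp_fin_two_eq_iff, Finsupp.single_eq_same, Finsupp.single_eq_of_ne (by decide)]
        omega
    -- hence `R = r₀ X₀ ^ d`, and the set is empty
    have hn₀eq : n₀ = Finsupp.single 0 d := by
      by_contra h; exact hr₀ (hall n₀ h)
    have hReq : R = monomial (Finsupp.single 0 d) (coeff n₀ R) := by
      refine MvPolynomial.ext _ _ (fun m => ?_)
      rw [coeff_monomial]
      split_ifs with h
      · rw [← h, hn₀eq]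
      · exact hall m (Ne.symm h)
    refine Set.Finite.subset Set.finite_empty ?_
    rintro p ⟨hp1, hp⟩
    exfalso
    rw [hReq, ← C_mul_X_pow_eq_monomial, map_mul, map_pow, aeval_C, aeval_X] at hp
    rw [hl0, zero_add, Matrix.cons_val_zero] at hp
    rcases mul_eq_zero.mp hp with h | h
    · exact hr₀ ((map_eq_zero_iff _ hιinj).mp h)
    · exact pow_ne_zero d (mul_ne_zero ht0 (Rat.cast_ne_zero.mpr hp1)) h
  · -- relatively prime: finitely many common zeros in `ℂ²`, and the rational points inject
    have hfin := finite_commonZeros_of_isRelPrime hP0 hrel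
    let Φ : ℚ × ℚ → (Fin 2 → ℂ) := fun p i => (((![p.1, p.2] : Fin 2 → ℚ) i : ℚ) : ℂ)
    have hΦ : Function.Injective Φ := by
      intro p p' h
      have h0 := congrFun h 0
      have h1 := congrFun h 1
      simp only [Φ, Matrix.cons_val_zero, Matrix.cons_val_one, Rat.cast_inj] at h0 h1
      exact Prod.ext h0 h1
    refine (hfin.preimage hΦ.injOn).subset ?_
    rintro p ⟨-, hp⟩
    simp only [Set.mem_preimage, Set.mem_setOf_eq]
    refine ⟨by rw [heval]; exact hp, ?_⟩
    have hx : Φ p = fun i => ι ((((![p.1, p.2] : Fin 2 → ℚ) i : ℚ) : (algebraicClosure ℚ ℂ))) := by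
      funext i; simp [Φ, hι]
    have h2 : eval (Φ p) f₁' =
        ι (eval (fun i => ((((![p.1, p.2] : Fin 2 → ℚ) i : ℚ) : (algebraicClosure ℚ ℂ)))) f₁) := by
      have h2' := MvPolynomial.eval₂_comp_left ι (RingHom.id _)
        (fun i => ((((![p.1, p.2] : Fin 2 → ℚ) i : ℚ) : (algebraicClosure ℚ ℂ)))) f₁
      rw [RingHom.comp_id] at h2'
      rw [hf₁', eval_map, hx]
      exact h2'.symm
    rw [h2, hf₁, eval_sum_monomial_apply, ← hx, heval, hp, map_zero, map_zero]

/-- Finiteness of the rational points `(x, y)`, `x ≠ 0`, with `R(t x, λ + t y) = 0` for every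
nonzero `R ∈ 𝔸[X₀, X₁]`, by induction over an irreducible factorisation. -/
theorem MixedPeriod.finite_zeros_of_ne_zero (lam t : ℂ)
    (ht : Transcendental (algebraicClosure ℚ ℂ) t)
    (hli : LinearIndependent (algebraicClosure ℚ ℂ) ![(1 : ℂ), lam, t])
    (R : MvPolynomial (Fin 2) (algebraicClosure ℚ ℂ)) (hR : R ≠ 0) :
    {q : ℚ × ℚ | q.1 ≠ 0 ∧ aeval (fun i => (![0, lam] : Fin 2 → ℂ) i +
      t * (((![q.1, q.2] : Fin 2 → ℚ) i : ℚ) : ℂ)) R = 0}.Finite := by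
  induction R using WfDvdMonoid.induction_on_irreducible with
  | zero => exact absurd rfl hR
  | unit u hu =>
    obtain ⟨c, hc, rfl⟩ := isUnit_iff_eq_C_of_isReduced.mp hu
    have hc0 : algebraMap (algebraicClosure ℚ ℂ) ℂ c ≠ 0 :=
      (map_ne_zero_iff _ (algebraMap (algebraicClosure ℚ ℂ) ℂ).injective).mpr hc.ne_zero
    refine Set.Finite.subset Set.finite_empty ?_
    rintro p ⟨-, hp⟩
    rw [aeval_C] at hp
    exact (hc0 hp).elim
  | mul a q ha hq IH =>
    refine ((MixedPeriod.finite_zeros_of_irreducible lam t ht hli q hq).union (IH ha)).subset ?_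
    rintro p ⟨hp1, hp⟩
    rw [map_mul, mul_eq_zero] at hp
    rcases hp with h | h
    · exact Or.inl ⟨hp1, h⟩
    · exact Or.inr ⟨hp1, h⟩

/-- **Core of `stub_mixedPeriodPocket`.** Let `t ∈ ℂ` be transcendental over `𝔸 = ℚ̄` and let
`1, λ, t` be linearly independent over `𝔸`. For every nonzero `R ∈ 𝔸[X₀, X₁]`, only finitely many
rational points `(x, y) ∈ ℚ²` with `x ≠ 0` satisfy `R(t x, λ + t y) = 0`. -/
theorem MixedPeriod.finite_ratPoints (lam t : ℂ) (ht : Transcendental (algebraicClosure ℚ ℂ) t)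
    (hli : LinearIndependent (algebraicClosure ℚ ℂ) ![(1 : ℂ), lam, t])
    (R : MvPolynomial (Fin 2) (algebraicClosure ℚ ℂ)) (hR : R ≠ 0) :
    {q : ℚ × ℚ | q.1 ≠ 0 ∧ aeval ![t * (q.1 : ℂ), lam + t * (q.2 : ℂ)] R = 0}.Finite := by
  have hpt : ∀ q : ℚ × ℚ, (![t * (q.1 : ℂ), lam + t * (q.2 : ℂ)] : Fin 2 → ℂ) =
      fun i => (![0, lam] : Fin 2 → ℂ) i + t * (((![q.1, q.2] : Fin 2 → ℚ) i : ℚ) : ℂ) := by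
    intro q
    funext i
    fin_cases i <;> simp
  refine (MixedPeriod.finite_zeros_of_ne_zero lam t ht hli R hR).subset ?_
  rintro q ⟨hq1, hq⟩
  exact ⟨hq1, by rw [← hpt q]; exact hq⟩

end Summit.Schanuel.Schanuel.Theorems

namespace Summit.Schanuel.Schanuel.Cruxes.SparsityTwo.CuspGermSchneiderSparsity
/-- **stub_mixedPeriodCore** (registered stub of line `cusp-germ-schneider-sparsity` = `MixedPeriod.finite_ratPoints`). -/
theorem stub_mixedPeriodCore : ∀ (lam t : ℂ), Transcendental ↥(algebraicClosure ℚ ℂ) t →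
    LinearIndependent ↥(algebraicClosure ℚ ℂ) ![(1 : ℂ), lam, t] →
    ∀ (R : MvPolynomial (Fin 2) ↥(algebraicClosure ℚ ℂ)), R ≠ 0 → Set.Finite {q : ℚ × ℚ | q.1 ≠ 0 ∧
      MvPolynomial.aeval ![t * (q.1 : ℂ), lam + t * (q.2 : ℂ)] R = 0} :=
  fun lam t ht hli R hR => Summit.Schanuel.Schanuel.Theorems.MixedPeriod.finite_ratPoints lam t ht hli R hR
end Summit.Schanuel.Schanuel.Cruxes.SparsityTwo.CuspGermSchneiderSparsity
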